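import Summits.CriticalPhenomena.Ising3DConformalLimit.Theorems.IsingEuclidUpgradeIsingEuclidUpgradeR2RotInvPowerLawRayProfiles
import Summits.CriticalPhenomena.Ising3DConformalLimit.Theses.HelsonAxis
import HarnessLib

/-!
# Crux `IsingEuclidUpgradeR2RotInvPowerLaw` (stmt-CriticalPhenomena-0634), line `tower_profile_rigidity`:
# the HELSON LINK — `AxialHelsonCone (18121) ∧ EtaBoundsExist (4662) ⇒ D1 ⇒ T1 ∧ S2`

Write `G := criticalTwoPoint 3` for the critical two-point function `⟨σ₀σ_x⟩_{β_c}` of the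
nearest-neighbour Ising model on `ℤ³` and `g(n) := G(n e₀)` for its axis sequence; `g > 0`
(`criticalTwoPoint_axis_pos`) and `g` is antitone (Messager–Miracle-Solé,
`criticalTwoPoint_axis_antitone`).

**Theorem** (`axisPowerLaw_of_axialHelsonCone_of_etaBounds`, registered; = item 17972
`HelsonForcing`, proved verbatim as `helsonForcing_proof`). Assume
* (item 18121, `AxialHelsonCone`) the order-2 multiplicative Helson cone on the axis: there is `ℓ₀`
  with `g(Nb)² ≤ g(N) g(Nb²)` for all `N ≥ ℓ₀`, `b ≥ 1`;
* (item 4662, `EtaBoundsExist`) two-sided power bounds `c‖x‖^{-κ} ≤ G(x) ≤ C‖x‖^{-κ}`, `κ = 1 + η`.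
Then the axial pure power law D1 holds: `g(n) n^{2Δ} → A > 0` (with `Δ = κ/2`).

Proof (elementary real analysis on the sequence `φ(n) := g(n) n^κ ∈ [c, C]`).
1. `0 ≤ κ`: otherwise `c n^{-κ} → ∞` contradicts `g(n) ≤ g(1)`.
2. DIVISIBILITY MONOTONICITY `φ(Nb) ≤ φ(N)` (`N ≥ max ℓ₀ 1`, `b ≥ 1`): the cone at the points `N b^m`
   makes `m ↦ ψ(m) := φ(N b^m)` log-convex (`ψ(m+1)² ≤ ψ(m) ψ(m+2)`), so the ratios `ψ(m+1)/ψ(m)` are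
   non-decreasing; if `q := ψ(1)/ψ(0) > 1` then `ψ(m) ≥ q^m ψ(0) → ∞`, contradicting `ψ ≤ C`.
3. With `A := inf_{n ≥ N₁} φ(n) ≥ c > 0` (`N₁ := max ℓ₀ 1`): given `a > A` pick `N₀ ≥ N₁` with
   `φ(N₀) < a`; for `n ≥ N₀` and `b := ⌊n/N₀⌋`, antitonicity and `0 ≤ κ` give
   `φ(n) ≤ g(N₀ b) (N₀(b+1))^κ = φ(N₀ b) ((b+1)/b)^κ ≤ φ(N₀) ((b+1)/b)^κ`, which is `< a` for `b`
   large. Hence `φ(n) → A`.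

**Corollaries** (registered). `towerLaw_of_axisPowerLaw` (D1 ⇒ T1, the subsequence `n = 2^j`),
`dilationLaw_of_axisPowerLaw` (D1 ⇒ S2: `g(kn)k^{2Δ}/g(n) = φ(kn)/φ(n) → 1`), and the glue
`IsingEuclidUpgradeR2RotInvPowerLaw_of_axialHelsonCone_of_etaBounds_of_rayProfiles`
(18121 ∧ 4662 ∧ A_rays ⇒ r2, through the landed TOWER × AXIS-DILATIONS × RAY-PROFILES glue).

References: H. Duminil-Copin, ICM 2022, §8.1 (the axial/isotropic pure power law on `ℤ³` is open)
[DuminilCopinICM2022]; the real analysis is folklore. No definitions are introduced; items 18121 and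
4662 enter as hypotheses only.
-/

noncomputable section

namespace Summit.CriticalPhenomena.Ising3DConformalLimit.Cruxes.IsingEuclidUpgradeR2RotInvPowerLaw.TowerProfileRigidity

open Filter Topology Literature.Probability.LatticeModels

/-! ### Real analysis: bounded log-convex sequences and the forcing lemma -/

/-- A positive, bounded, log-convex sequence is non-increasing at the start: if
`ψ(m+1)² ≤ ψ(m) ψ(m+2)` for all `m` and `ψ ≤ C`, then `ψ 1 ≤ ψ 0` (otherwise the non-decreasing
ratios force geometric growth). [folklore] -/
private theorem logConvex_bounded_head_le {ψ : ℕ → ℝ} {C : ℝ} (hpos : ∀ m, 0 < ψ m)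
    (hconv : ∀ m, ψ (m + 1) ^ 2 ≤ ψ m * ψ (m + 2)) (hbd : ∀ m, ψ m ≤ C) : ψ 1 ≤ ψ 0 := by
  refine le_of_not_gt fun h => ?_
  -- the ratios are non-decreasing: `ψ 1 / ψ 0 ≤ ψ (m+1) / ψ m`
  have hratio : ∀ m, ψ 1 * ψ m ≤ ψ 0 * ψ (m + 1) := by
    intro m
    induction m with
    | zero => rw [mul_comm]
    | succ m ih =>
      have hc : ψ (m + 1) ^ 2 ≤ ψ m * ψ (m + 1 + 1) := hconv m
      have h1 : ψ 1 * ψ (m + 1) * ψ (m + 1) ≤ ψ 0 * ψ (m + 1 + 1) * ψ (m + 1) := by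
        calc ψ 1 * ψ (m + 1) * ψ (m + 1) = ψ 1 * ψ (m + 1) ^ 2 := by ring
          _ ≤ ψ 1 * (ψ m * ψ (m + 1 + 1)) := mul_le_mul_of_nonneg_left hc (hpos 1).le
          _ = (ψ 1 * ψ m) * ψ (m + 1 + 1) := by ring
          _ ≤ (ψ 0 * ψ (m + 1)) * ψ (m + 1 + 1) := mul_le_mul_of_nonneg_right ih (hpos _).le
          _ = ψ 0 * ψ (m + 1 + 1) * ψ (m + 1) := by ring
      exact le_of_mul_le_mul_right h1 (hpos (m + 1))
  -- geometric growth with ratio `q > 1`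
  have h0 : ψ 0 ≠ 0 := (hpos 0).ne'
  set q : ℝ := ψ 1 / ψ 0 with hq
  have hq1 : 1 < q := (one_lt_div (hpos 0)).2 h
  have hgeom : ∀ m, q ^ m * ψ 0 ≤ ψ m := by
    intro m
    induction m with
    | zero => simp
    | succ m ih =>
      calc q ^ (m + 1) * ψ 0 = q * (q ^ m * ψ 0) := by ring
        _ ≤ q * ψ m := mul_le_mul_of_nonneg_left ih (zero_le_one.trans hq1.le)
        _ = ψ 1 * ψ m / ψ 0 := by rw [hq]; ring
        _ ≤ ψ 0 * ψ (m + 1) / ψ 0 := div_le_div_of_nonneg_right (hratio m) (hpos 0).le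
        _ = ψ (m + 1) := by field_simp
  obtain ⟨m, hm⟩ := ((tendsto_pow_atTop_atTop_of_one_lt hq1).eventually_gt_atTop (C / ψ 0)).exists
  have hCm : C < q ^ m * ψ 0 := (div_lt_iff₀ (hpos 0)).1 hm
  exact absurd ((hCm.trans_le (hgeom m)).trans_le (hbd m)) (lt_irrefl C)

/-- The exponent of two-sided power bounds around a positive antitone sequence is non-negative:
`c n^{-κ} ≤ g(n) ≤ g(1)` for all `n ≥ 1` forces `0 ≤ κ`. [folklore] -/
private theorem exponent_nonneg_of_antitone {g : ℕ → ℝ} {κ c : ℝ} (hc : 0 < c) (ganti : Antitone g)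
    (hlow : ∀ n : ℕ, 1 ≤ n → c * (n : ℝ) ^ (-κ) ≤ g n) : 0 ≤ κ := by
  refine le_of_not_gt fun hκ => ?_
  have h1 : Tendsto (fun n : ℕ => c * (n : ℝ) ^ (-κ)) atTop atTop :=
    Tendsto.const_mul_atTop hc ((tendsto_rpow_atTop (neg_pos.2 hκ)).comp tendsto_natCast_atTop_atTop)
  obtain ⟨n, hn1, hn2⟩ := ((eventually_ge_atTop 1).and (h1.eventually_gt_atTop (g 1))).exists
  exact absurd ((hn2.trans_le (hlow n hn1)).trans_le (ganti hn1)) (lt_irrefl _)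

/-- DIVISIBILITY MONOTONICITY. If `g > 0`, `φ(n) := g(n) n^κ ≤ C` for `n ≥ 1`, and the order-2
multiplicative cone `g(Nb)² ≤ g(N) g(Nb²)` holds for `N ≥ ℓ₀`, `b ≥ 1`, then `φ(Nb) ≤ φ(N)` for
`N ≥ max ℓ₀ 1`, `b ≥ 1`: the sequence `m ↦ φ(N b^m)` is log-convex and bounded. [folklore] -/
private theorem phi_mul_le_phi {g : ℕ → ℝ} {κ C : ℝ} {ℓ₀ : ℕ} (gpos : ∀ n, 0 < g n)
    (hup : ∀ n : ℕ, 1 ≤ n → g n * (n : ℝ) ^ κ ≤ C)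
    (hcone : ∀ N b : ℕ, ℓ₀ ≤ N → 1 ≤ b → g (N * b) ^ 2 ≤ g N * g (N * b ^ 2))
    {N b : ℕ} (hN : ℓ₀ ≤ N) (hN1 : 1 ≤ N) (hb : 1 ≤ b) :
    g (N * b) * ((N * b : ℕ) : ℝ) ^ κ ≤ g N * (N : ℝ) ^ κ := by
  have hNpos : 0 < N := hN1
  have hbpos : 0 < b := hb
  set ψ : ℕ → ℝ := fun m => g (N * b ^ m) * ((N * b ^ m : ℕ) : ℝ) ^ κ with hψ
  have hxpos : ∀ m, (0 : ℝ) < ((N * b ^ m : ℕ) : ℝ) := fun m => by positivity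
  have hpos : ∀ m, 0 < ψ m := fun m => mul_pos (gpos _) (Real.rpow_pos_of_pos (hxpos m) _)
  have hbd : ∀ m, ψ m ≤ C := fun m => hup (N * b ^ m) (Nat.mul_pos hNpos (pow_pos hbpos m))
  have hconv : ∀ m, ψ (m + 1) ^ 2 ≤ ψ m * ψ (m + 2) := by
    intro m
    have hc := hcone (N * b ^ m) b (hN.trans (Nat.le_mul_of_pos_right _ (pow_pos hbpos m))) hb
    rw [show N * b ^ m * b = N * b ^ (m + 1) by ring,
      show N * b ^ m * b ^ 2 = N * b ^ (m + 2) by ring] at hc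
    have hxx : ((N * b ^ (m + 1) : ℕ) : ℝ) * ((N * b ^ (m + 1) : ℕ) : ℝ) =
        ((N * b ^ m : ℕ) : ℝ) * ((N * b ^ (m + 2) : ℕ) : ℝ) := by
      push_cast; ring
    have hnn : (0 : ℝ) ≤ ((N * b ^ m : ℕ) : ℝ) ^ κ * ((N * b ^ (m + 2) : ℕ) : ℝ) ^ κ :=
      mul_nonneg (Real.rpow_nonneg (Nat.cast_nonneg _) _) (Real.rpow_nonneg (Nat.cast_nonneg _) _)
    simp only [hψ]
    calc (g (N * b ^ (m + 1)) * ((N * b ^ (m + 1) : ℕ) : ℝ) ^ κ) ^ 2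
        = g (N * b ^ (m + 1)) ^ 2 *
            (((N * b ^ m : ℕ) : ℝ) ^ κ * ((N * b ^ (m + 2) : ℕ) : ℝ) ^ κ) := by
          rw [mul_pow, sq (((N * b ^ (m + 1) : ℕ) : ℝ) ^ κ),
            ← Real.mul_rpow (Nat.cast_nonneg _) (Nat.cast_nonneg _), hxx,
            Real.mul_rpow (Nat.cast_nonneg _) (Nat.cast_nonneg _)]
      _ ≤ (g (N * b ^ m) * g (N * b ^ (m + 2))) *
            (((N * b ^ m : ℕ) : ℝ) ^ κ * ((N * b ^ (m + 2) : ℕ) : ℝ) ^ κ) :=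
          mul_le_mul_of_nonneg_right hc hnn
      _ = g (N * b ^ m) * ((N * b ^ m : ℕ) : ℝ) ^ κ *
            (g (N * b ^ (m + 2)) * ((N * b ^ (m + 2) : ℕ) : ℝ) ^ κ) := by ring
  have h := logConvex_bounded_head_le hpos hconv hbd
  simp only [hψ, pow_one, pow_zero, mul_one] at h
  exact h

/-- THE FORCING LEMMA (abstract form of item 17972). A positive antitone sequence `g` with two-sided
power bounds `c n^{-κ} ≤ g(n) ≤ C n^{-κ}` (`c > 0`) and the eventual order-2 multiplicative cone
`g(Nb)² ≤ g(N) g(Nb²)` obeys a pure power law: `g(n) n^{2Δ} → A > 0` (`Δ = κ/2`,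
`A = inf_{n ≥ max ℓ₀ 1} g(n) n^κ`). [folklore] -/
private theorem forcing_of_cone_of_bounds {g : ℕ → ℝ} {κ c C : ℝ} {ℓ₀ : ℕ} (gpos : ∀ n, 0 < g n)
    (ganti : Antitone g) (hc : 0 < c)
    (hlow : ∀ n : ℕ, 1 ≤ n → c * (n : ℝ) ^ (-κ) ≤ g n)
    (hup : ∀ n : ℕ, 1 ≤ n → g n ≤ C * (n : ℝ) ^ (-κ))
    (hcone : ∀ N b : ℕ, ℓ₀ ≤ N → 1 ≤ b → g (N * b) ^ 2 ≤ g N * g (N * b ^ 2)) :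
    ∃ Δ A : ℝ, 0 < A ∧ Tendsto (fun n : ℕ => g n * (n : ℝ) ^ (2 * Δ)) atTop (𝓝 A) := by
  have hκ : 0 ≤ κ := exponent_nonneg_of_antitone hc ganti hlow
  -- `φ(n) := g(n) n^κ ∈ [c, C]` for `n ≥ 1`
  set φ : ℕ → ℝ := fun n => g n * (n : ℝ) ^ κ with hφ
  have hφup : ∀ n : ℕ, 1 ≤ n → φ n ≤ C := by
    intro n hn
    have hx : (0 : ℝ) < n := by exact_mod_cast hn
    calc φ n = g n * (n : ℝ) ^ κ := rfl
      _ ≤ C * (n : ℝ) ^ (-κ) * (n : ℝ) ^ κ :=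
          mul_le_mul_of_nonneg_right (hup n hn) (Real.rpow_nonneg hx.le _)
      _ = C := by rw [mul_assoc, ← Real.rpow_add hx, neg_add_cancel, Real.rpow_zero, mul_one]
  have hφlow : ∀ n : ℕ, 1 ≤ n → c ≤ φ n := by
    intro n hn
    have hx : (0 : ℝ) < n := by exact_mod_cast hn
    calc c = c * (n : ℝ) ^ (-κ) * (n : ℝ) ^ κ := by
          rw [mul_assoc, ← Real.rpow_add hx, neg_add_cancel, Real.rpow_zero, mul_one]
      _ ≤ g n * (n : ℝ) ^ κ := mul_le_mul_of_nonneg_right (hlow n hn) (Real.rpow_nonneg hx.le _)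
  -- divisibility monotonicity
  have hdiv : ∀ N b : ℕ, ℓ₀ ≤ N → 1 ≤ N → 1 ≤ b → φ (N * b) ≤ φ N :=
    fun N b hN hN1 hb => phi_mul_le_phi gpos hφup hcone hN hN1 hb
  -- the limit `A := inf_{n ≥ N₁} φ(n)`
  set N₁ : ℕ := max ℓ₀ 1 with hN₁
  set S : Set ℝ := φ '' Set.Ici N₁ with hS
  have hne : S.Nonempty := ⟨φ N₁, N₁, Set.self_mem_Ici, rfl⟩
  have hSc : ∀ x ∈ S, c ≤ x := by
    rintro x ⟨n, hn, rfl⟩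
    exact hφlow n (le_trans (le_max_right _ _) hn)
  have hbdd : BddBelow S := ⟨c, hSc⟩
  set A : ℝ := sInf S with hA
  have hcA : c ≤ A := le_csInf hne hSc
  have hAφ : ∀ n, N₁ ≤ n → A ≤ φ n := fun n hn => csInf_le hbdd ⟨n, hn, rfl⟩
  refine ⟨κ / 2, A, hc.trans_le hcA, ?_⟩
  have h2 : 2 * (κ / 2) = κ := by ring
  rw [h2]
  refine tendsto_order.2 ⟨fun a ha => ?_, fun a ha => ?_⟩
  · filter_upwards [eventually_ge_atTop N₁] with n hn
    exact ha.trans_le (hAφ n hn)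
  · obtain ⟨x, ⟨N₀, hN₀, rfl⟩, hlt⟩ := exists_lt_of_csInf_lt hne ha
    have hN₀ℓ : ℓ₀ ≤ N₀ := le_trans (le_max_left _ _) hN₀
    have hN₀1 : 1 ≤ N₀ := le_trans (le_max_right _ _) hN₀
    have hN₀pos : 0 < N₀ := hN₀1
    -- the comparison sequence `φ(N₀) ((b+1)/b)^κ → φ(N₀) < a`
    have hlim : Tendsto (fun b : ℕ => φ N₀ * ((((b : ℕ) : ℝ) + 1) / b) ^ κ) atTop (𝓝 (φ N₀)) := by
      have h1 : Tendsto (fun b : ℕ => (((b : ℕ) : ℝ) + 1) / b) atTop (𝓝 1) := by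
        have h := (tendsto_const_div_atTop_nhds_zero_nat (1 : ℝ)).const_add 1
        rw [add_zero] at h
        refine h.congr' ?_
        filter_upwards [eventually_ge_atTop 1] with b hb
        have hb' : (0 : ℝ) < b := by exact_mod_cast hb
        field_simp
      have h2 := h1.rpow_const (p := κ) (Or.inl one_ne_zero)
      rw [Real.one_rpow] at h2
      simpa using (tendsto_const_nhds (x := φ N₀)).mul h2
    obtain ⟨B, hB⟩ := eventually_atTop.1 ((tendsto_order.1 hlim).2 a hlt)
    refine eventually_atTop.2 ⟨max B 1 * N₀, fun n hn => ?_⟩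
    have hbmax : max B 1 ≤ n / N₀ := (Nat.le_div_iff_mul_le hN₀pos).2 hn
    set b : ℕ := n / N₀ with hbdef
    have hbB : B ≤ b := le_trans (le_max_left _ _) hbmax
    have hb1 : 1 ≤ b := le_trans (le_max_right _ _) hbmax
    have hbpos : (0 : ℝ) < b := by exact_mod_cast hb1
    have hlo : N₀ * b ≤ n := Nat.mul_div_le n N₀
    have hhi : n < N₀ * (b + 1) := Nat.lt_mul_div_succ n hN₀pos
    have hsplit : ((N₀ * (b + 1) : ℕ) : ℝ) = ((N₀ * b : ℕ) : ℝ) * ((((b : ℕ) : ℝ) + 1) / b) := by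
      push_cast
      rw [mul_assoc, mul_div_assoc', mul_div_cancel_left₀ _ hbpos.ne']
    have hrnn : (0 : ℝ) ≤ ((((b : ℕ) : ℝ) + 1) / b) ^ κ :=
      Real.rpow_nonneg (div_nonneg (by positivity) (Nat.cast_nonneg _)) _
    calc φ n = g n * (n : ℝ) ^ κ := rfl
      _ ≤ g (N₀ * b) * ((N₀ * (b + 1) : ℕ) : ℝ) ^ κ :=
          mul_le_mul (ganti hlo) (Real.rpow_le_rpow (Nat.cast_nonneg _) (by exact_mod_cast hhi.le) hκ)
            (Real.rpow_nonneg (Nat.cast_nonneg _) _) (gpos _).le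
      _ = φ (N₀ * b) * ((((b : ℕ) : ℝ) + 1) / b) ^ κ := by
          rw [hsplit, Real.mul_rpow (Nat.cast_nonneg _) (div_nonneg (by positivity) (Nat.cast_nonneg _)),
            ← mul_assoc]
      _ ≤ φ N₀ * ((((b : ℕ) : ℝ) + 1) / b) ^ κ :=
          mul_le_mul_of_nonneg_right (hdiv N₀ b hN₀ℓ hN₀1 hb1) hrnn
      _ < a := hB b hbB

/-! ### The Helson link for the critical axis sequence on `ℤ³` -/

/-- **HELSON LINK, D1 from items 18121 and 4662** (registered): the order-2 axial Helson cone
`AxialHelsonCone` (item 18121) and the two-sided η-bounds `EtaBoundsExist` (item 4662) force the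
axial pure power law `⟨σ₀σ_{n e₁}⟩_{β_c} n^{2Δ} → c > 0` of the critical Ising model on `ℤ³` — the
content of item 17972 (`HelsonForcing`). The Ising inputs are positivity and Messager–Miracle-Solé
antitonicity of the axis sequence; the rest is `forcing_of_cone_of_bounds`.
[cite: DuminilCopinICM2022, §8.1] -/
theorem axisPowerLaw_of_axialHelsonCone_of_etaBounds : Summit.CriticalPhenomena.Ising3DConformalLimit.Theses.HelsonAxis.AxialHelsonCone → Summit.CriticalPhenomena.Ising3DConformalLimit.Theses.HelsonAxis.EtaBoundsExist → ∃ Δ c : ℝ, 0 < c ∧ Filter.Tendsto (fun n : ℕ => Literature.Probability.LatticeModels.criticalTwoPoint 3 (Pi.single 0 ((n : ℕ) : ℤ)) * (n : ℝ) ^ (2 * Δ)) Filter.atTop (nhds c) := by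
  intro hH hE
  obtain ⟨ℓ₀, -, hcone⟩ := hH
  obtain ⟨η, c, C, hc, hb⟩ := hE
  have hnorm : ∀ n : ℕ, ‖(Pi.single 0 ((n : ℕ) : ℤ) : Site 3)‖ = (n : ℝ) := fun n => by
    rw [norm_single_axis, Int.cast_natCast, Nat.abs_cast]
  have hne : ∀ n : ℕ, 1 ≤ n → (Pi.single 0 ((n : ℕ) : ℤ) : Site 3) ≠ 0 := by
    intro n hn h
    have h' := congrArg (fun x : Site 3 => ‖x‖) h
    simp only [hnorm, norm_zero] at h'
    have : (0 : ℝ) < n := by exact_mod_cast hn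
    exact absurd h' this.ne'
  exact forcing_of_cone_of_bounds (g := fun n : ℕ => criticalTwoPoint 3 (Pi.single 0 ((n : ℕ) : ℤ)))
    criticalTwoPoint_axis_pos criticalTwoPoint_axis_antitone hc
    (fun n hn => by simpa only [hnorm] using (hb _ (hne n hn)).1)
    (fun n hn => by simpa only [hnorm] using (hb _ (hne n hn)).2)
    hcone

/-- **Item 17972 `HelsonForcing` verbatim** (registered): `AxialHelsonCone → EtaBoundsExist →
∃ Δ A, 0 < A ∧ g(n) n^{2Δ} → A` — the same proposition as
`axisPowerLaw_of_axialHelsonCone_of_etaBounds`. [cite: DuminilCopinICM2022, §8.1] -/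
theorem helsonForcing_proof : Summit.CriticalPhenomena.Ising3DConformalLimit.Theses.HelsonAxis.HelsonForcing :=
  axisPowerLaw_of_axialHelsonCone_of_etaBounds

/-- **D1 ⇒ T1** (registered): the axial pure power law restricted to the dyadic tower `n = 2^j`.
[folklore] -/
theorem towerLaw_of_axisPowerLaw : (∃ Δ c : ℝ, 0 < c ∧ Filter.Tendsto (fun n : ℕ => Literature.Probability.LatticeModels.criticalTwoPoint 3 (Pi.single 0 ((n : ℕ) : ℤ)) * (n : ℝ) ^ (2 * Δ)) Filter.atTop (nhds c)) → ∃ Δ c : ℝ, 0 < c ∧ Filter.Tendsto (fun j : ℕ => Literature.Probability.LatticeModels.criticalTwoPoint 3 (Pi.single 0 ((2 ^ j : ℕ) : ℤ)) * ((2 ^ j : ℕ) : ℝ) ^ (2 * Δ)) Filter.atTop (nhds c) := by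
  rintro ⟨Δ, c, hc, h⟩
  exact ⟨Δ, c, hc, h.comp (tendsto_pow_atTop_atTop_of_one_lt one_lt_two)⟩

/-- **D1 ⇒ S2** (registered): with `φ(n) := g(n) n^{2Δ} → c > 0`, for every `k ≥ 1`,
`g(kn) k^{2Δ} / g(n) = φ(kn)/φ(n) → c/c = 1`. [folklore] -/
theorem dilationLaw_of_axisPowerLaw : (∃ Δ c : ℝ, 0 < c ∧ Filter.Tendsto (fun n : ℕ => Literature.Probability.LatticeModels.criticalTwoPoint 3 (Pi.single 0 ((n : ℕ) : ℤ)) * (n : ℝ) ^ (2 * Δ)) Filter.atTop (nhds c)) → ∃ Δ : ℝ, ∀ k : ℕ, 1 ≤ k → Filter.Tendsto (fun n : ℕ => Literature.Probability.LatticeModels.criticalTwoPoint 3 (Pi.single 0 ((k * n : ℕ) : ℤ)) * (k : ℝ) ^ (2 * Δ) / Literature.Probability.LatticeModels.criticalTwoPoint 3 (Pi.single 0 ((n : ℕ) : ℤ))) Filter.atTop (nhds 1) := by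
  rintro ⟨Δ, c, hc, h⟩
  refine ⟨Δ, fun k hk => ?_⟩
  have hk0 : 0 < k := hk
  have hkn : Tendsto (fun n : ℕ => k * n) atTop atTop := Tendsto.const_mul_atTop' hk0 tendsto_id
  have h2 : Tendsto (fun n : ℕ =>
      (criticalTwoPoint 3 (Pi.single 0 ((k * n : ℕ) : ℤ)) * ((k * n : ℕ) : ℝ) ^ (2 * Δ)) /
        (criticalTwoPoint 3 (Pi.single 0 ((n : ℕ) : ℤ)) * (n : ℝ) ^ (2 * Δ))) atTop (𝓝 1) := by
    have := (h.comp hkn).div h hc.ne'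
    rw [div_self hc.ne'] at this
    exact this
  refine h2.congr' ?_
  filter_upwards [eventually_ge_atTop 1] with n hn
  have hn' : (0 : ℝ) < n := by exact_mod_cast hn
  have hnpow : (n : ℝ) ^ (2 * Δ) ≠ 0 := (Real.rpow_pos_of_pos hn' _).ne'
  have hcast : ((k * n : ℕ) : ℝ) = (k : ℝ) * (n : ℝ) := Nat.cast_mul k n
  rw [hcast, Real.mul_rpow (Nat.cast_nonneg _) (Nat.cast_nonneg _), ← mul_assoc,
    mul_div_mul_right _ _ hnpow]

/-- **HELSON LINK to the crux** (registered glue): `AxialHelsonCone` (18121), `EtaBoundsExist` (4662)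
and the ray profiles A_rays imply the rotation-invariant pure power law r2 (item 0634): D1 gives T1 and
S2, and the landed TOWER × AXIS-DILATIONS × RAY-PROFILES glue concludes.
[cite: DuminilCopinICM2022, §8.1] -/
theorem IsingEuclidUpgradeR2RotInvPowerLaw_of_axialHelsonCone_of_etaBounds_of_rayProfiles : Summit.CriticalPhenomena.Ising3DConformalLimit.Theses.HelsonAxis.AxialHelsonCone → Summit.CriticalPhenomena.Ising3DConformalLimit.Theses.HelsonAxis.EtaBoundsExist → (∀ v : Literature.Probability.LatticeModels.Site 3, v ≠ 0 → ∃ c : ℝ, 0 < c ∧ Filter.Tendsto (fun n : ℕ => Literature.Probability.LatticeModels.criticalTwoPoint 3 (((n : ℕ) : ℤ) • v) / Literature.Probability.LatticeModels.criticalTwoPoint 3 (Pi.single 0 ((⌊(n : ℝ) * Real.sqrt (∑ i, ((v i : ℝ)) ^ 2)⌋₊ : ℕ) : ℤ))) Filter.atTop (nhds c)) → Summit.CriticalPhenomena.Ising3DConformalLimit.Theses.IsingEuclidUpgrade.IsingEuclidUpgradeR2RotInvPowerLaw :=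
  fun hH hE hA =>
    IsingEuclidUpgradeR2RotInvPowerLaw_of_towerLaw_of_dilationLaw_of_rayProfiles
      (towerLaw_of_axisPowerLaw (axisPowerLaw_of_axialHelsonCone_of_etaBounds hH hE))
      (dilationLaw_of_axisPowerLaw (axisPowerLaw_of_axialHelsonCone_of_etaBounds hH hE)) hA

end Summit.CriticalPhenomena.Ising3DConformalLimit.Cruxes.IsingEuclidUpgradeR2RotInvPowerLaw.TowerProfileRigidity

end
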